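import Summits.Ventures.YMGap.RobustBall.SummableMassGap
import Summits.Ventures.YMGap.RobustBall.MassGapOnBallS
import Summits.Ventures.YMGap.RobustBall.RowsSU2
import HarnessLib

/-!
# Venture YMGap, track ROBUST-BALL (tier 2) — `MassGapOnBallZdS` from a one-link pair (every `N`), the `SU(2)`
# ball, and certified rows at weight `e^{t} = q`

HONEST FRAMING. WHAT THIS IS: a venture file (cell `pub-ymgap`, track Y2 ROBUST-BALL, seat rb-p1) closing
the tier-2 target type of `MassGapOnBallS.lean` with the theorem of `SummableMassGap.lean`:
* `massGapOnBallZdS_of_pair` — for `d, N ≥ 1`, a one-link Poincaré/variance pair `(c, v)` on the ball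
  `‖B‖_op ≤ 2(d-1)|β|`, and `t > 0`: `6(d-1)|β| e^{a} e^{t} √(c v) + e^{a/2} √c Λ < 1 ⇒ MassGapOnBallZdS d N β a Λ t`;
* `massGapOnBallZdS_of_schemas` (the same with the cell's named schemas `OneLinkPoincareSUN` /
  `OneLinkVarianceBound`), `suN_massGapOnBallZdS_bakryEmery` (ALL `N ≥ 2`, hypothesis-free Bakry–Émery pair:
  `6(d-1)|β| e^{a} e^{t}/(1/2 - b) + e^{a/2} Λ/√(N(1/2 - b)) < 1`, `b = 2(d-1)|β| < 1/2`) and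
  `su3_massGapOnBallZdS_of_certificates` (`SU(3)` on the cell's displayed certificates H1/H2, engine-2 lineage:
  `(14/15)(d-1)|β_W| e^{a} e^{t} + e^{a/2} √(4/5) Λ < 1`);
* `su2_massGapOnBallZdS` / `_dim4` — the sharp `SU(2)` pair `(2/3, 8/3)`:
  `2(d-1)|β_W| e^{a} e^{t} + e^{a/2} √(2/3) Λ < 1 ⇒ MassGapOnBallZdS d 2 (β_W/4) a Λ t`;
* CERTIFIED ROWS `MassGapOnBallZdS 4 2 (β⋆_W/4) (2ε) ε (log q)` (oscillation load `2ε`, weighted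
  diagonal-free cross load `ε` at weight `q^{‖e - y‖_∞}`, clustering rate `log q` per lattice unit), from
  the numeric majorants of `RowsSU2.lean` (`exp_le_taylor4`, `sqrt_two_thirds_le`), exact rational
  arithmetic (`norm_num`): at `q = 2`: `(1/80, 0.470)`, `(1/40, 0.346)`, `(1/32, 0.294)`, `(1/24, 0.219)`,
  `(1/20, 0.167)`, `(1/16, 0.097)`; at `q = 3/2`: `(1/20, 0.248)`, `(1/16, 0.186)`, `(1/12, 0.097)`,
  `(1/10, 0.036)`; lineage (B) (sharp variance `v = 2`, `β_W ≤ 1/6`; `su2_massGapOnBallZdS_sharp`, `su2_rowBS`) at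
  `q = 2`: `(1/40, 0.376)`, `(1/32, 0.328)`, `(1/24, 0.258)`, `(1/20, 0.209)`, `(1/16, 0.143)`, `(1/12, 0.049)`. SCALING: the tier-2 row at `(β_W, ε, log q)` is the tier-1 lineage-(A) row at
  `(q β_W, ε)` (lineage B: at `(q β_W, ε)` with the radius constraint on `β_W` itself) — the weight multiplies only
  the Wilson part of the row sum.
WHAT IT IS NOT: lattice strong coupling (`β_W ≤ 1/16` at `q = 2`); nothing about the continuum or Clay.
Certificates: `HOME/rb/certs/SU2-Z4-SINGLELINK-ROWS-rbp1.md` §tier-2 (script `rows_s.py`, exact rationals).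
-/

noncomputable section

open MeasureTheory Filter Function ProbabilityTheory Real Topology
open scoped NNReal
open Literature.Probability.LatticeModels
open Literature.Probability.LatticeModels.DobrushinMetric
open Literature.MathematicalPhysics.QuantumLattice
open Literature.MathematicalPhysics.QuantumFieldTheory hiding ZdEdge
open Summit.QuantumFields.BalabanUV.InfraRed.StrongCouplingPoincareDoorSUN (OneLinkPoincareSUN OneLinkPoincareSUN.mono
  oneLinkPoincareSUN_two_sharp oneLinkPoincareSUN_bakryEmery)
open Summit.QuantumFields.BalabanUV.InfraRed.StrongCouplingVarianceDoorSUN (OneLinkVarianceBound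
  oneLinkVarianceBound_bakryEmery)

namespace Summit.Ventures.YMGap.RobustBall

variable {d N : ℕ}

/-- **Mass gap on the tier-2 ball from a one-link pair**: for `d, N ≥ 1`, a Poincaré/variance pair `(c, v)`
on the ball `‖B‖_op ≤ b ⊇ 2(d-1)|β|`, a weight `t > 0` and loads `(a, Λ)` with
`6(d-1)|β| e^{a} e^{t} √(c v) + e^{a/2} √c Λ < 1`, every member of `MemBallZdS a Λ t` has the mass gap
(`perturbedMassGapS_SU`). -/
theorem massGapOnBallZdS_of_pair (hd : 1 ≤ d) (hN : 1 ≤ N) {β b c v a Λ t : ℝ}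
    (hc : 0 ≤ c) (hv : 0 ≤ v) (hb : |β| * (2 * ((d : ℝ) - 1)) ≤ b)
    (hP : ∀ B : Matrix (Fin N) (Fin N) ℂ, matrixOpNorm B ≤ b →
      ∀ (ψ : Matrix.specialUnitaryGroup (Fin N) ℂ → ℝ) (M : ℝ), 0 ≤ M →
        (∀ x y, |ψ x - ψ y| ≤ M * suFrobDist x y) →
        Var[ψ; (haarProbability (Matrix.specialUnitaryGroup (Fin N) ℂ)).tilted
          fun g => (N : ℝ) * ((g : Matrix (Fin N) (Fin N) ℂ) * B).trace.re] ≤ c * M ^ 2)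
    (hVB : ∀ B : Matrix (Fin N) (Fin N) ℂ, matrixOpNorm B ≤ b → ∀ Δ : Matrix (Fin N) (Fin N) ℂ,
      Var[fun g : Matrix.specialUnitaryGroup (Fin N) ℂ =>
          (N : ℝ) * ((g : Matrix (Fin N) (Fin N) ℂ) * Δ).trace.re;
        (haarProbability (Matrix.specialUnitaryGroup (Fin N) ℂ)).tilted
          fun g => (N : ℝ) * ((g : Matrix (Fin N) (Fin N) ℂ) * B).trace.re] ≤ v * frobNorm Δ ^ 2)
    (ht : 0 < t)
    (hρ : 6 * ((d : ℝ) - 1) * |β| * (exp a * exp t * Real.sqrt (c * v)) + exp (a / 2) * Real.sqrt c * Λ < 1) :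
    MassGapOnBallZdS d N β a Λ t := by
  intro W hW
  obtain ⟨B, hB⟩ := hW.summable
  obtain ⟨osc, lip, ℓ, hosc, hlip, hoscs, hosca, hlips, hℓ, hℓs, hℓt⟩ := hW.loads
  exact perturbedMassGapS_SU hd hN hc hv hb hP hVB hB hW.continuous hW.dependsOn hosc hoscs hosca hlip hlips
    hℓ ht hℓs hℓt hρ

/-- The same with the cell's NAMED one-link schemas `OneLinkPoincareSUN N b c` / `OneLinkVarianceBound N b v`
(radius `b ≥ 2(d-1)|β|`), the form in which the cell's certified pairs are recorded. -/
theorem massGapOnBallZdS_of_schemas (hd : 1 ≤ d) (hN : 1 ≤ N) {β b c v a Λ t : ℝ} (hc : 0 ≤ c) (hv : 0 ≤ v)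
    (hP : OneLinkPoincareSUN N b c) (hV : OneLinkVarianceBound N b v) (hb : |β| * (2 * ((d : ℝ) - 1)) ≤ b)
    (ht : 0 < t)
    (hρ : 6 * ((d : ℝ) - 1) * |β| * (exp a * exp t * Real.sqrt (c * v)) + exp (a / 2) * Real.sqrt c * Λ < 1) :
    MassGapOnBallZdS d N β a Λ t :=
  massGapOnBallZdS_of_pair hd hN hc hv hb (fun B hB => hP B hB) (fun B hB => hV B hB) ht hρ

/-- **ALL `N ≥ 2`, EVERY `d ≥ 1`, HYPOTHESIS-FREE — mass gap on the tier-2 ball from the Bakry–Émery one-link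
pair** (`oneLinkPoincareSUN_bakryEmery`, `oneLinkVarianceBound_bakryEmery`; `√(c v) = 1/(1/2 - b)`, `√c = 1/√(N(1/2 - b))`,
`b = 2(d-1)|β| < 1/2`): `6(d-1)|β| e^{a} e^{t}/(1/2 - b) + e^{a/2} Λ/√(N(1/2 - b)) < 1`, `t > 0`
`⇒ MassGapOnBallZdS d N β a Λ t`. -/
theorem suN_massGapOnBallZdS_bakryEmery (hd : 1 ≤ d) (hN : 2 ≤ N) {β a Λ t : ℝ} (ht : 0 < t)
    (hb : |β| * (2 * ((d : ℝ) - 1)) < 1 / 2)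
    (hρ : 6 * ((d : ℝ) - 1) * |β| * (exp a * exp t) / (1 / 2 - |β| * (2 * ((d : ℝ) - 1))) +
      exp (a / 2) * Λ / Real.sqrt ((N : ℝ) * (1 / 2 - |β| * (2 * ((d : ℝ) - 1)))) < 1) :
    MassGapOnBallZdS d N β a Λ t := by
  set b : ℝ := |β| * (2 * ((d : ℝ) - 1)) with hbdef
  have hNpos : (0 : ℝ) < N := by exact_mod_cast (show 0 < N by omega)
  have hgap : 0 < 1 / 2 - b := by linarith
  have hP := oneLinkPoincareSUN_bakryEmery hN hb
  have hV := oneLinkVarianceBound_bakryEmery hN hb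
  have hc : (0 : ℝ) ≤ 1 / ((N : ℝ) * (1 / 2 - b)) := by positivity
  have hv : (0 : ℝ) ≤ (N : ℝ) / (1 / 2 - b) := by positivity
  refine massGapOnBallZdS_of_pair hd (by omega) hc hv le_rfl (fun B hB => hP B hB) (fun B hB => hV B hB) ht ?_
  have hsq1 : Real.sqrt (1 / ((N : ℝ) * (1 / 2 - b)) * ((N : ℝ) / (1 / 2 - b))) = 1 / (1 / 2 - b) := by
    rw [show 1 / ((N : ℝ) * (1 / 2 - b)) * ((N : ℝ) / (1 / 2 - b)) = (1 / (1 / 2 - b)) ^ 2 by field_simp,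
      Real.sqrt_sq (by positivity)]
  have hsq2 : Real.sqrt (1 / ((N : ℝ) * (1 / 2 - b))) = 1 / Real.sqrt ((N : ℝ) * (1 / 2 - b)) := by
    rw [Real.sqrt_div' _ (mul_nonneg hNpos.le hgap.le), Real.sqrt_one]
  rw [hsq1, hsq2]
  calc 6 * ((d : ℝ) - 1) * |β| * (exp a * exp t * (1 / (1 / 2 - b))) +
        exp (a / 2) * (1 / Real.sqrt ((N : ℝ) * (1 / 2 - b))) * Λ
      = 6 * ((d : ℝ) - 1) * |β| * (exp a * exp t) / (1 / 2 - b) +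
        exp (a / 2) * Λ / Real.sqrt ((N : ℝ) * (1 / 2 - b)) := by ring
    _ < 1 := hρ

/-- **`SU(3)`, every `d ≥ 1`, ON THE CELL'S CERTIFICATES** H1 `OneLinkPoincareSUN 3 (3/5) (4/5)` and
H2 `OneLinkVarianceBound 3 (11/30) (49/20)` (engine-2 lineage; `√(c v) = 7/5`, `√c = √(4/5)`; displayed hypotheses,
nothing asserted about them): for `(d-1)|β_W| ≤ 33/20` ('t Hooft `β = β_W/9`, radius `11/30`) and `t > 0`,
`(14/15)(d-1)|β_W| e^{a} e^{t} + e^{a/2} √(4/5) Λ < 1 ⇒ MassGapOnBallZdS d 3 (β_W/9) a Λ t`. -/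
theorem su3_massGapOnBallZdS_of_certificates (hd : 1 ≤ d) {βW a Λ t : ℝ}
    (hP : OneLinkPoincareSUN 3 (3 / 5) (4 / 5)) (hV : OneLinkVarianceBound 3 (11 / 30) (49 / 20))
    (hR : ((d : ℝ) - 1) * |βW| ≤ 33 / 20) (ht : 0 < t)
    (hρ : 14 / 15 * (((d : ℝ) - 1) * |βW|) * (exp a * exp t) + exp (a / 2) * Real.sqrt (4 / 5) * Λ < 1) :
    MassGapOnBallZdS d 3 (βW / 9) a Λ t := by
  have hP' : OneLinkPoincareSUN 3 (11 / 30) (4 / 5) := hP.mono (by norm_num) le_rfl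
  have hb : |βW / 9| * (2 * ((d : ℝ) - 1)) ≤ 11 / 30 := by
    rw [abs_div, abs_of_pos (by norm_num : (0 : ℝ) < 9)]
    nlinarith [hR, abs_nonneg βW]
  refine massGapOnBallZdS_of_schemas hd (by norm_num) (by norm_num) (by norm_num) hP' hV hb ht ?_
  have hsq : Real.sqrt (4 / 5 * (49 / 20 : ℝ)) = 7 / 5 := by
    rw [show (4 / 5 * (49 / 20 : ℝ)) = (7 / 5) ^ 2 by norm_num, Real.sqrt_sq (by norm_num)]
  rw [hsq, abs_div, abs_of_pos (by norm_num : (0 : ℝ) < 9)]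
  calc 6 * ((d : ℝ) - 1) * (|βW| / 9) * (exp a * exp t * (7 / 5)) + exp (a / 2) * Real.sqrt (4 / 5) * Λ
      = 14 / 15 * (((d : ℝ) - 1) * |βW|) * (exp a * exp t) + exp (a / 2) * Real.sqrt (4 / 5) * Λ := by ring
    _ < 1 := hρ

/-- **The tier-2 `SU(2)` ball on `ℤ^d`** (sharp pair `(c, v) = (2/3, 8/3)`, `oneLinkPoincareSUN_two_sharp` +
`linVariance_of_poincare`): `2(d-1)|β_W| e^{a} e^{t} + e^{a/2} √(2/3) Λ < 1`, `t > 0`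
`⇒ MassGapOnBallZdS d 2 (β_W/4) a Λ t`. -/
theorem su2_massGapOnBallZdS (hd : 1 ≤ d) {βW a Λ t : ℝ} (ht : 0 < t)
    (hρ : 2 * ((d : ℝ) - 1) * |βW| * (exp a * exp t) + exp (a / 2) * Real.sqrt (2 / 3) * Λ < 1) :
    MassGapOnBallZdS d 2 (βW / 4) a Λ t := by
  have hc : (0 : ℝ) ≤ 2 / 3 := by norm_num
  have hP : ∀ B : Matrix (Fin 2) (Fin 2) ℂ, matrixOpNorm B ≤ |βW / 4| * (2 * ((d : ℝ) - 1)) →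
      ∀ (ψ : Matrix.specialUnitaryGroup (Fin 2) ℂ → ℝ) (M : ℝ), 0 ≤ M →
        (∀ x y, |ψ x - ψ y| ≤ M * suFrobDist x y) →
        Var[ψ; (haarProbability (Matrix.specialUnitaryGroup (Fin 2) ℂ)).tilted
          fun g => ((2 : ℕ) : ℝ) * ((g : Matrix (Fin 2) (Fin 2) ℂ) * B).trace.re] ≤ 2 / 3 * M ^ 2 :=
    fun B hB ψ M hM hψ => oneLinkPoincareSUN_two_sharp _ B hB ψ M hM hψ
  have hVB := linVariance_of_poincare (N := 2) hP
  have hv : (0 : ℝ) ≤ 2 / 3 * ((2 : ℕ) : ℝ) ^ 2 := by norm_num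
  refine massGapOnBallZdS_of_pair hd (by norm_num) hc hv le_rfl hP hVB ht ?_
  have hsq : Real.sqrt (2 / 3 * (2 / 3 * ((2 : ℕ) : ℝ) ^ 2)) = 4 / 3 := by
    rw [show (2 / 3 * (2 / 3 * ((2 : ℕ) : ℝ) ^ 2) : ℝ) = (4 / 3) ^ 2 by norm_num,
      Real.sqrt_sq (by norm_num)]
  rw [hsq]
  have e : 6 * ((d : ℝ) - 1) * |βW / 4| * (exp a * exp t * (4 / 3)) =
      2 * ((d : ℝ) - 1) * |βW| * (exp a * exp t) := by
    rw [abs_div, abs_of_pos (by norm_num : (0 : ℝ) < 4)]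
    ring
  rw [e]
  exact hρ

/-- The `d = 4` reading: `6|β_W| e^{a} e^{t} + e^{a/2} √(2/3) Λ < 1`, `t > 0`
`⇒ MassGapOnBallZdS 4 2 (β_W/4) a Λ t`. -/
theorem su2_massGapOnBallZdS_dim4 {βW a Λ t : ℝ} (ht : 0 < t)
    (hρ : 6 * |βW| * (exp a * exp t) + exp (a / 2) * Real.sqrt (2 / 3) * Λ < 1) :
    MassGapOnBallZdS 4 2 (βW / 4) a Λ t :=
  su2_massGapOnBallZdS (by norm_num) ht (by
    have h6 : (2 : ℝ) * (((4 : ℕ) : ℝ) - 1) = 6 := by norm_num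
    calc 2 * (((4 : ℕ) : ℝ) - 1) * |βW| * (exp a * exp t) + exp (a / 2) * Real.sqrt (2 / 3) * Λ
        = 6 * |βW| * (exp a * exp t) + exp (a / 2) * Real.sqrt (2 / 3) * Λ := by rw [h6]
      _ < 1 := hρ)

/-! ### Certified rows at weight `e^{t} = q`: `ρ = 6 β_W q e^{2ε} + e^{ε} √(2/3) ε < 1` -/

/-- Tier-2 row from numeric majorants: at weight `t = log q` (`q > 1`), oscillation load `2ε` and weighted
cross load `ε`, the row sum is majorised by `6 β_W q T(2ε) + T(ε) · 0.8165 · ε` with the Taylor bound `T`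
of `exp_le_taylor4` and `√(2/3) ≤ 0.8165`. -/
theorem su2_rowS {βW ε q : ℝ} (hq : 1 < q) (hβ : 0 ≤ βW) (hε0 : 0 ≤ ε) (hε1 : ε ≤ 1 / 2)
    (h : 6 * βW * q * (1 + 2 * ε + (2 * ε) ^ 2 / 2 + (2 * ε) ^ 3 / 6 + 5 / 96 * (2 * ε) ^ 4) +
      (1 + ε + ε ^ 2 / 2 + ε ^ 3 / 6 + 5 / 96 * ε ^ 4) * (8165 / 10000) * ε < 1) :
    MassGapOnBallZdS 4 2 (βW / 4) (2 * ε) ε (Real.log q) := by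
  have hq0 : 0 < q := zero_lt_one.trans hq
  refine su2_massGapOnBallZdS_dim4 (Real.log_pos hq) ?_
  have h1 := exp_le_taylor4 (x := 2 * ε) (by linarith) (by linarith)
  have h2 := exp_le_taylor4 (x := ε) hε0 (by linarith)
  rw [abs_of_nonneg hβ, show 2 * ε / 2 = ε by ring, Real.exp_log hq0]
  calc 6 * βW * (exp (2 * ε) * q) + exp ε * Real.sqrt (2 / 3) * ε
      ≤ 6 * βW * ((1 + 2 * ε + (2 * ε) ^ 2 / 2 + (2 * ε) ^ 3 / 6 + 5 / 96 * (2 * ε) ^ 4) * q) +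
        (1 + ε + ε ^ 2 / 2 + ε ^ 3 / 6 + 5 / 96 * ε ^ 4) * (8165 / 10000) * ε := by
        gcongr
        · exact sqrt_two_thirds_le
    _ = 6 * βW * q * (1 + 2 * ε + (2 * ε) ^ 2 / 2 + (2 * ε) ^ 3 / 6 + 5 / 96 * (2 * ε) ^ 4) +
        (1 + ε + ε ^ 2 / 2 + ε ^ 3 / 6 + 5 / 96 * ε ^ 4) * (8165 / 10000) * ε := by ring
    _ < 1 := h

/-- Row (S, q = 2): `(β⋆_W, ε) = (1/80, 0.470)`, rate `log 2`. -/
theorem su2_rowS2_1_80 : MassGapOnBallZdS 4 2 ((1 / 80 : ℝ) / 4) (2 * (47 / 100)) (47 / 100) (Real.log 2) :=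
  su2_rowS (by norm_num) (by norm_num) (by norm_num) (by norm_num) (by norm_num)

/-- Row (S, q = 2): `(β⋆_W, ε) = (1/40, 0.346)`, rate `log 2`. -/
theorem su2_rowS2_1_40 : MassGapOnBallZdS 4 2 ((1 / 40 : ℝ) / 4) (2 * (173 / 500)) (173 / 500) (Real.log 2) :=
  su2_rowS (by norm_num) (by norm_num) (by norm_num) (by norm_num) (by norm_num)

/-- Row (S, q = 2): `(β⋆_W, ε) = (1/32, 0.294)`, rate `log 2`. -/
theorem su2_rowS2_1_32 : MassGapOnBallZdS 4 2 ((1 / 32 : ℝ) / 4) (2 * (147 / 500)) (147 / 500) (Real.log 2) :=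
  su2_rowS (by norm_num) (by norm_num) (by norm_num) (by norm_num) (by norm_num)

/-- Row (S, q = 2): `(β⋆_W, ε) = (1/24, 0.219)`, rate `log 2`. -/
theorem su2_rowS2_1_24 : MassGapOnBallZdS 4 2 ((1 / 24 : ℝ) / 4) (2 * (219 / 1000)) (219 / 1000) (Real.log 2) :=
  su2_rowS (by norm_num) (by norm_num) (by norm_num) (by norm_num) (by norm_num)

/-- Row (S, q = 2): `(β⋆_W, ε) = (1/20, 0.167)`, rate `log 2`. -/
theorem su2_rowS2_1_20 : MassGapOnBallZdS 4 2 ((1 / 20 : ℝ) / 4) (2 * (167 / 1000)) (167 / 1000) (Real.log 2) :=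
  su2_rowS (by norm_num) (by norm_num) (by norm_num) (by norm_num) (by norm_num)

/-- Row (S, q = 2): `(β⋆_W, ε) = (1/16, 0.097)`, rate `log 2`. -/
theorem su2_rowS2_1_16 : MassGapOnBallZdS 4 2 ((1 / 16 : ℝ) / 4) (2 * (97 / 1000)) (97 / 1000) (Real.log 2) :=
  su2_rowS (by norm_num) (by norm_num) (by norm_num) (by norm_num) (by norm_num)

/-- Row (S, q = 3/2): `(β⋆_W, ε) = (1/20, 0.248)`, rate `log (3/2)`. -/
theorem su2_rowS32_1_20 :
    MassGapOnBallZdS 4 2 ((1 / 20 : ℝ) / 4) (2 * (31 / 125)) (31 / 125) (Real.log (3 / 2)) :=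
  su2_rowS (by norm_num) (by norm_num) (by norm_num) (by norm_num) (by norm_num)

/-- Row (S, q = 3/2): `(β⋆_W, ε) = (1/16, 0.186)`, rate `log (3/2)`. -/
theorem su2_rowS32_1_16 :
    MassGapOnBallZdS 4 2 ((1 / 16 : ℝ) / 4) (2 * (93 / 500)) (93 / 500) (Real.log (3 / 2)) :=
  su2_rowS (by norm_num) (by norm_num) (by norm_num) (by norm_num) (by norm_num)

/-- Row (S, q = 3/2): `(β⋆_W, ε) = (1/12, 0.097)`, rate `log (3/2)`. -/
theorem su2_rowS32_1_12 :
    MassGapOnBallZdS 4 2 ((1 / 12 : ℝ) / 4) (2 * (97 / 1000)) (97 / 1000) (Real.log (3 / 2)) :=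
  su2_rowS (by norm_num) (by norm_num) (by norm_num) (by norm_num) (by norm_num)

/-- Row (S, q = 3/2): `(β⋆_W, ε) = (1/10, 0.036)`, rate `log (3/2)`. -/
theorem su2_rowS32_1_10 :
    MassGapOnBallZdS 4 2 ((1 / 10 : ℝ) / 4) (2 * (9 / 250)) (9 / 250) (Real.log (3 / 2)) :=
  su2_rowS (by norm_num) (by norm_num) (by norm_num) (by norm_num) (by norm_num)

/-! ### Lineage (B) at tier 2: the sharp `SU(2)` variance `v = 2` (`β_W ≤ 1/6`), `ρ = 3√3 β_W q e^{2ε} + e^{ε} √(2/3) ε` -/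

/-- **Tier-2 `SU(2)` ball, `d = 4`, sharp variance** (pair `(2/3, 2)` on `‖B‖_op ≤ 1/4`, i.e. `|β_W| ≤ 1/6`;
`su2_linVariance_sharp`): `3√3 |β_W| e^{a} e^{t} + e^{a/2} √(2/3) Λ < 1`, `t > 0` `⇒ MassGapOnBallZdS 4 2 (β_W/4) a Λ t`.
The weight multiplies the Wilson part only, the radius constraint stays `|β_W| ≤ 1/6`. -/
theorem su2_massGapOnBallZdS_sharp {βW a Λ t : ℝ} (hβ : |βW| ≤ 1 / 6) (ht : 0 < t)
    (hρ : 3 * Real.sqrt 3 * |βW| * (exp a * exp t) + exp (a / 2) * Real.sqrt (2 / 3) * Λ < 1) :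
    MassGapOnBallZdS 4 2 (βW / 4) a Λ t := by
  have hc : (0 : ℝ) ≤ 2 / 3 := by norm_num
  have hb : |βW / 4| * (2 * (((4 : ℕ) : ℝ) - 1)) ≤ 1 / 4 := by
    rw [abs_div, abs_of_pos (by norm_num : (0 : ℝ) < 4)]
    norm_num
    linarith
  have hP : ∀ B : Matrix (Fin 2) (Fin 2) ℂ, matrixOpNorm B ≤ 1 / 4 →
      ∀ (ψ : Matrix.specialUnitaryGroup (Fin 2) ℂ → ℝ) (M : ℝ), 0 ≤ M →
        (∀ x y, |ψ x - ψ y| ≤ M * suFrobDist x y) →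
        Var[ψ; (haarProbability (Matrix.specialUnitaryGroup (Fin 2) ℂ)).tilted
          fun g => ((2 : ℕ) : ℝ) * ((g : Matrix (Fin 2) (Fin 2) ℂ) * B).trace.re] ≤ 2 / 3 * M ^ 2 :=
    fun B hB ψ M hM hψ => oneLinkPoincareSUN_two_sharp _ B hB ψ M hM hψ
  refine massGapOnBallZdS_of_pair (d := 4) (N := 2) (by norm_num) (by norm_num) hc zero_le_two hb hP
    (su2_linVariance_sharp le_rfl) ht ?_
  have hsq : Real.sqrt (2 / 3 * 2) = 2 * Real.sqrt 3 / 3 := by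
    have h3 : (2 * Real.sqrt 3 / 3) ^ 2 = 2 / 3 * 2 := by
      rw [div_pow, mul_pow, Real.sq_sqrt (by norm_num)]; norm_num
    rw [← h3, Real.sqrt_sq (by positivity)]
  rw [hsq]
  have e : 6 * (((4 : ℕ) : ℝ) - 1) * |βW / 4| * (exp a * exp t * (2 * Real.sqrt 3 / 3)) =
      3 * Real.sqrt 3 * |βW| * (exp a * exp t) := by
    rw [abs_div, abs_of_pos (by norm_num : (0 : ℝ) < 4)]
    ring
  rw [e]
  exact hρ

/-- Tier-2 lineage-(B) row from numeric majorants (`√3 ≤ 1.732051`, `√(2/3) ≤ 0.8165`, Taylor `T`): at weight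
`t = log q`, `3 · 1.732051 · β_W q T(2ε) + T(ε) · 0.8165 · ε < 1`, `0 ≤ β_W ≤ 1/6` `⇒ MassGapOnBallZdS 4 2 (β_W/4) (2ε) ε (log q)`. -/
theorem su2_rowBS {βW ε q : ℝ} (hq : 1 < q) (hβ : 0 ≤ βW) (hβ6 : βW ≤ 1 / 6) (hε0 : 0 ≤ ε) (hε1 : ε ≤ 1 / 2)
    (h : 3 * (1732051 / 1000000) * βW * q * (1 + 2 * ε + (2 * ε) ^ 2 / 2 + (2 * ε) ^ 3 / 6 + 5 / 96 * (2 * ε) ^ 4) +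
      (1 + ε + ε ^ 2 / 2 + ε ^ 3 / 6 + 5 / 96 * ε ^ 4) * (8165 / 10000) * ε < 1) :
    MassGapOnBallZdS 4 2 (βW / 4) (2 * ε) ε (Real.log q) := by
  have hq0 : 0 < q := zero_lt_one.trans hq
  refine su2_massGapOnBallZdS_sharp (by rw [abs_of_nonneg hβ]; exact hβ6) (Real.log_pos hq) ?_
  have h1 := exp_le_taylor4 (x := 2 * ε) (by linarith) (by linarith)
  have h2 := exp_le_taylor4 (x := ε) hε0 (by linarith)
  rw [abs_of_nonneg hβ, show 2 * ε / 2 = ε by ring, Real.exp_log hq0]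
  calc 3 * Real.sqrt 3 * βW * (exp (2 * ε) * q) + exp ε * Real.sqrt (2 / 3) * ε
      ≤ 3 * (1732051 / 1000000) * βW * ((1 + 2 * ε + (2 * ε) ^ 2 / 2 + (2 * ε) ^ 3 / 6 + 5 / 96 * (2 * ε) ^ 4) * q) +
        (1 + ε + ε ^ 2 / 2 + ε ^ 3 / 6 + 5 / 96 * ε ^ 4) * (8165 / 10000) * ε := by
        gcongr
        · exact sqrt_three_le_bound
        · exact sqrt_two_thirds_le
    _ = 3 * (1732051 / 1000000) * βW * q * (1 + 2 * ε + (2 * ε) ^ 2 / 2 + (2 * ε) ^ 3 / 6 + 5 / 96 * (2 * ε) ^ 4) +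
        (1 + ε + ε ^ 2 / 2 + ε ^ 3 / 6 + 5 / 96 * ε ^ 4) * (8165 / 10000) * ε := by ring
    _ < 1 := h

/-- Row (BS, q = 2): `(β⋆_W, ε) = (1/40, 0.376)`, rate `log 2`. -/
theorem su2_rowBS2_1_40 : MassGapOnBallZdS 4 2 ((1 / 40 : ℝ) / 4) (2 * (47 / 125)) (47 / 125) (Real.log 2) :=
  su2_rowBS (by norm_num) (by norm_num) (by norm_num) (by norm_num) (by norm_num) (by norm_num)

/-- Row (BS, q = 2): `(β⋆_W, ε) = (1/32, 0.328)`, rate `log 2`. -/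
theorem su2_rowBS2_1_32 : MassGapOnBallZdS 4 2 ((1 / 32 : ℝ) / 4) (2 * (41 / 125)) (41 / 125) (Real.log 2) :=
  su2_rowBS (by norm_num) (by norm_num) (by norm_num) (by norm_num) (by norm_num) (by norm_num)

/-- Row (BS, q = 2): `(β⋆_W, ε) = (1/24, 0.258)`, rate `log 2`. -/
theorem su2_rowBS2_1_24 : MassGapOnBallZdS 4 2 ((1 / 24 : ℝ) / 4) (2 * (129 / 500)) (129 / 500) (Real.log 2) :=
  su2_rowBS (by norm_num) (by norm_num) (by norm_num) (by norm_num) (by norm_num) (by norm_num)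

/-- Row (BS, q = 2): `(β⋆_W, ε) = (1/20, 0.209)`, rate `log 2`. -/
theorem su2_rowBS2_1_20 : MassGapOnBallZdS 4 2 ((1 / 20 : ℝ) / 4) (2 * (209 / 1000)) (209 / 1000) (Real.log 2) :=
  su2_rowBS (by norm_num) (by norm_num) (by norm_num) (by norm_num) (by norm_num) (by norm_num)

/-- Row (BS, q = 2): `(β⋆_W, ε) = (1/16, 0.143)`, rate `log 2` — the tier-2 twin of the headline row. -/
theorem su2_rowBS2_1_16 : MassGapOnBallZdS 4 2 ((1 / 16 : ℝ) / 4) (2 * (143 / 1000)) (143 / 1000) (Real.log 2) :=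
  su2_rowBS (by norm_num) (by norm_num) (by norm_num) (by norm_num) (by norm_num) (by norm_num)

/-- Row (BS, q = 2): `(β⋆_W, ε) = (1/12, 0.049)`, rate `log 2`. -/
theorem su2_rowBS2_1_12 : MassGapOnBallZdS 4 2 ((1 / 12 : ℝ) / 4) (2 * (49 / 1000)) (49 / 1000) (Real.log 2) :=
  su2_rowBS (by norm_num) (by norm_num) (by norm_num) (by norm_num) (by norm_num) (by norm_num)

end Summit.Ventures.YMGap.RobustBall
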